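import Mathlib
import Summits.KontsevichZagierPeriods.Zeta5Search.Certificates.RecordRayPhatData
import HarnessLib

/-! # Record ray, (N) for every `n ≥ 1` — identification points 00/12: `j = 0 … 29` (S4-R1 item #10, step N-2c)

30 of the 356 kernel point identities `identAt k` (`RecordRayPhatData`), `k = j − 177`, one theorem per point, each
`decide +kernel` (≈ 3 s; fam-tele's computable mirror `PgenM` of the integer period matrix against `(c0 · Ĝ(k)) • P̂(k)`),
and their assembly `chunk_0` on the index interval `[0, 30)`.  The twelve chunks are concatenated in `RecordRayIdentWindow`.

Provenance: gen-2 g32's kernel-checked scratch `AllN_G15.lean` (2026-08-22, rc 0 / 0 sorry, axioms propext ·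
Classical.choice · Quot.sound), built on fam-tele g15's generic record-ray interface (`RecordRayGenericForms/Steps`,
`RecordRayMirror`, `RecordRayRaySteps`, `RecordRayChain`, all in the tree); data from gen-2 g31 (`P̂`, align) and fam-tele
g14 (`conn/PATH.md`).  Staged for the tree by gen-2 g33 (S4-R1 item #10).

HONEST FRAMING: systematic search; no irrationality claim unless certified; this is clause (N) of Brown–Zudilin's Theorem 1
(arXiv:2210.03391) for THEIR OWN record cell — the non-vanishing of their linear forms — and nothing about ζ(5) beyond that;
records UNMOVED. -/

namespace Summit.KontsevichZagierPeriods.Zeta5Search.RecordRay.Generic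

section Window

/- The point evaluations are memory-hungry kernel reductions (≈ 3 s each); elaborating them in PARALLEL killed a farm
   node twice (gen-2 g32).  Serialize them. -/
set_option Elab.async false

/-- Point identity `PgenM k = (c0 · Ĝ(k)) • P̂(k)` at `k = 0 − 177 = -177` (kernel `decide`). -/
theorem ip_0 : IdP 0 = true := by decide +kernel
/-- Point identity `PgenM k = (c0 · Ĝ(k)) • P̂(k)` at `k = 1 − 177 = -176` (kernel `decide`). -/
theorem ip_1 : IdP 1 = true := by decide +kernel
/-- Point identity `PgenM k = (c0 · Ĝ(k)) • P̂(k)` at `k = 2 − 177 = -175` (kernel `decide`). -/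
theorem ip_2 : IdP 2 = true := by decide +kernel
/-- Point identity `PgenM k = (c0 · Ĝ(k)) • P̂(k)` at `k = 3 − 177 = -174` (kernel `decide`). -/
theorem ip_3 : IdP 3 = true := by decide +kernel
/-- Point identity `PgenM k = (c0 · Ĝ(k)) • P̂(k)` at `k = 4 − 177 = -173` (kernel `decide`). -/
theorem ip_4 : IdP 4 = true := by decide +kernel
/-- Point identity `PgenM k = (c0 · Ĝ(k)) • P̂(k)` at `k = 5 − 177 = -172` (kernel `decide`). -/
theorem ip_5 : IdP 5 = true := by decide +kernel
/-- Point identity `PgenM k = (c0 · Ĝ(k)) • P̂(k)` at `k = 6 − 177 = -171` (kernel `decide`). -/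
theorem ip_6 : IdP 6 = true := by decide +kernel
/-- Point identity `PgenM k = (c0 · Ĝ(k)) • P̂(k)` at `k = 7 − 177 = -170` (kernel `decide`). -/
theorem ip_7 : IdP 7 = true := by decide +kernel
/-- Point identity `PgenM k = (c0 · Ĝ(k)) • P̂(k)` at `k = 8 − 177 = -169` (kernel `decide`). -/
theorem ip_8 : IdP 8 = true := by decide +kernel
/-- Point identity `PgenM k = (c0 · Ĝ(k)) • P̂(k)` at `k = 9 − 177 = -168` (kernel `decide`). -/
theorem ip_9 : IdP 9 = true := by decide +kernel
/-- Point identity `PgenM k = (c0 · Ĝ(k)) • P̂(k)` at `k = 10 − 177 = -167` (kernel `decide`). -/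
theorem ip_10 : IdP 10 = true := by decide +kernel
/-- Point identity `PgenM k = (c0 · Ĝ(k)) • P̂(k)` at `k = 11 − 177 = -166` (kernel `decide`). -/
theorem ip_11 : IdP 11 = true := by decide +kernel
/-- Point identity `PgenM k = (c0 · Ĝ(k)) • P̂(k)` at `k = 12 − 177 = -165` (kernel `decide`). -/
theorem ip_12 : IdP 12 = true := by decide +kernel
/-- Point identity `PgenM k = (c0 · Ĝ(k)) • P̂(k)` at `k = 13 − 177 = -164` (kernel `decide`). -/
theorem ip_13 : IdP 13 = true := by decide +kernel
/-- Point identity `PgenM k = (c0 · Ĝ(k)) • P̂(k)` at `k = 14 − 177 = -163` (kernel `decide`). -/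
theorem ip_14 : IdP 14 = true := by decide +kernel
/-- Point identity `PgenM k = (c0 · Ĝ(k)) • P̂(k)` at `k = 15 − 177 = -162` (kernel `decide`). -/
theorem ip_15 : IdP 15 = true := by decide +kernel
/-- Point identity `PgenM k = (c0 · Ĝ(k)) • P̂(k)` at `k = 16 − 177 = -161` (kernel `decide`). -/
theorem ip_16 : IdP 16 = true := by decide +kernel
/-- Point identity `PgenM k = (c0 · Ĝ(k)) • P̂(k)` at `k = 17 − 177 = -160` (kernel `decide`). -/
theorem ip_17 : IdP 17 = true := by decide +kernel
/-- Point identity `PgenM k = (c0 · Ĝ(k)) • P̂(k)` at `k = 18 − 177 = -159` (kernel `decide`). -/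
theorem ip_18 : IdP 18 = true := by decide +kernel
/-- Point identity `PgenM k = (c0 · Ĝ(k)) • P̂(k)` at `k = 19 − 177 = -158` (kernel `decide`). -/
theorem ip_19 : IdP 19 = true := by decide +kernel
/-- Point identity `PgenM k = (c0 · Ĝ(k)) • P̂(k)` at `k = 20 − 177 = -157` (kernel `decide`). -/
theorem ip_20 : IdP 20 = true := by decide +kernel
/-- Point identity `PgenM k = (c0 · Ĝ(k)) • P̂(k)` at `k = 21 − 177 = -156` (kernel `decide`). -/
theorem ip_21 : IdP 21 = true := by decide +kernel
/-- Point identity `PgenM k = (c0 · Ĝ(k)) • P̂(k)` at `k = 22 − 177 = -155` (kernel `decide`). -/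
theorem ip_22 : IdP 22 = true := by decide +kernel
/-- Point identity `PgenM k = (c0 · Ĝ(k)) • P̂(k)` at `k = 23 − 177 = -154` (kernel `decide`). -/
theorem ip_23 : IdP 23 = true := by decide +kernel
/-- Point identity `PgenM k = (c0 · Ĝ(k)) • P̂(k)` at `k = 24 − 177 = -153` (kernel `decide`). -/
theorem ip_24 : IdP 24 = true := by decide +kernel
/-- Point identity `PgenM k = (c0 · Ĝ(k)) • P̂(k)` at `k = 25 − 177 = -152` (kernel `decide`). -/
theorem ip_25 : IdP 25 = true := by decide +kernel
/-- Point identity `PgenM k = (c0 · Ĝ(k)) • P̂(k)` at `k = 26 − 177 = -151` (kernel `decide`). -/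
theorem ip_26 : IdP 26 = true := by decide +kernel
/-- Point identity `PgenM k = (c0 · Ĝ(k)) • P̂(k)` at `k = 27 − 177 = -150` (kernel `decide`). -/
theorem ip_27 : IdP 27 = true := by decide +kernel
/-- Point identity `PgenM k = (c0 · Ĝ(k)) • P̂(k)` at `k = 28 − 177 = -149` (kernel `decide`). -/
theorem ip_28 : IdP 28 = true := by decide +kernel
/-- Point identity `PgenM k = (c0 · Ĝ(k)) • P̂(k)` at `k = 29 − 177 = -148` (kernel `decide`). -/
theorem ip_29 : IdP 29 = true := by decide +kernel

/-- The point identities for `0 ≤ j < 30` (`k = -177 … -148`), assembled. -/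
theorem chunk_0 : ∀ j : ℕ, 0 ≤ j → j < 30 → IdP j = true :=
  chunk_step ip_0 <| chunk_step ip_1 <| chunk_step ip_2 <| chunk_step ip_3 <| chunk_step ip_4 <|
  chunk_step ip_5 <| chunk_step ip_6 <| chunk_step ip_7 <| chunk_step ip_8 <| chunk_step ip_9 <|
  chunk_step ip_10 <| chunk_step ip_11 <| chunk_step ip_12 <| chunk_step ip_13 <| chunk_step ip_14 <|
  chunk_step ip_15 <| chunk_step ip_16 <| chunk_step ip_17 <| chunk_step ip_18 <| chunk_step ip_19 <|
  chunk_step ip_20 <| chunk_step ip_21 <| chunk_step ip_22 <| chunk_step ip_23 <| chunk_step ip_24 <|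
  chunk_step ip_25 <| chunk_step ip_26 <| chunk_step ip_27 <| chunk_step ip_28 <| chunk_step ip_29 <| chunk_base

end Window

end Summit.KontsevichZagierPeriods.Zeta5Search.RecordRay.Generic
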